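import Summits.HodgeConjecture.CorCM.MultiFieldWeilQuinticTower
import Summits.HodgeConjecture.CorCM.MultiFieldWeilNonIsomorphicDecics
import Summits.HodgeConjecture.CorCM.MultiFieldWeilCubicTower
import HarnessLib

/-!
# MULTI-FIELD WEIL ENGINE — THE DECIC TOWER: ANY NUMBER of `(2,3)`-fivefolds over decic CM fields sharing `k`, each field admitting NO `k`-embedding into
# the compositum of the previous ones — the Hodge conjecture for every product of copies, given ONLY Markman's hyperbolic-sixfold theorem; THREE fivefolds

Cell `pub-hodgecm2` (COR-CM), seat b30 gen 32 (2026-08-24); count-neutral own lane MULTI-FIELD WEIL ENGINE (stem `MultiFieldWeil*`), the decic twin of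
`CorCM/MultiFieldWeilCubicTower.lean` (Q3) built on the quintic step `CorCM/MultiFieldWeilQuinticTower.lean` (Q6) and G2b's
`hodgeConjectureFor_biproduct_comp_of_decics_of_finrank` (`CorCM/MultiFieldWeilGaloisHeadlines.lean`).  Theorems only; no definition, no named fact, no `sorry`.
HONEST FRAMING: conditional on the displayed Markman hyperbolic-sixfold binder only; `HC_CM` is NOT proved and not asserted.

* §1 **`finrank_sup_adjoin_range_of_forall_not_range_subset_five`** — ONE QUINTIC STEP in number-field form: `[K : k] = 5`, `A ⊂ ℂ` of degree `5^m [k : ℚ]`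
  containing `τ(k)`, `s` an embedding of `K` over `τ`; if no embedding of `K` over `τ` has image inside `A`, then `[A · s(K) : ℚ] = 5 [A : ℚ]` (a conjugate of
  `s β` inside `A` would be a root of the minimal polynomial of `β` over `k` in `A`, i.e. the `k`-embedding `K = k(β) → A`, `β ↦ γ`; then Q6).
* §2 **`finrank_adjoin_iUnion_of_quinticTower`** — induction on `r`: `r` relative quintics, each with NO `k`-embedding into the compositum of the earlier images,
  have compositum of degree `5^r [k : ℚ]` (the `5`-power degree of the earlier compositum is exactly what the quintic step needs — this is why the decic tower
  works although "no embedding ⟹ disjoint" FAILS for a quintic against a general base).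
* §3 **`hodgeConjectureFor_biproduct_comp_of_decics_of_quinticTower`** (+ dominated) — THE HEADLINE: `E = A 0 ⊨ (k; {τ})` and ANY NUMBER of `(2,3)`-fivefolds
  `F_m ⊨ (K_m; Φ_m)` over decic `K_m ∋ k` under the tower condition: the Hodge conjecture for EVERY product of copies `E^a × ∏ F_m^{b_m}`, GIVEN ONLY
  `Markman2025_weilClasses_algebraic_hyperbolicSixfold`.
* §4 **`hodgeConjectureFor_biproduct_comp_of_three_decics`** — THREE fivefolds: `Hom(K_1, K_0) = ∅` and no `τ`-embedding of `K_2` into `ℚ(τk) · s₀(K_0) · s₁(K_1)`;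
  §5 **`hodgeConjectureFor_biproduct_comp_vec_of_three_decics_of_isEmpty`** — its `vec` form on `![E, F₀, F₁, F₂]` for Weil-type fivefolds (`k`-signature `(2,3)`
  or `(3,2)`, normalised by `exists_realisation_card_eq_two`).  Pairwise non-isomorphy of three decic fields is NOT enough (two disjoint cyclic quintics generate
  a `C₅ × C₅`-extension with four more quintic subextensions).

[cite: Markman2025SecantWeil, Thm 1.5.1] [cite: Lang2002, V §1 Prop. 1.2, VI §1 Thm. 1.1, Cor. 1.6 and V §2 Thm. 2.8] [cite: Shimura1998, §18.2 Lemma (i)]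

## References
* [Markman2025SecantWeil] E. Markman, Thm 1.5.1.  [Lang2002] S. Lang, *Algebra*, GTM 211, V §1–§2, VI §1.  [Shimura1998] G. Shimura, *Abelian varieties with CM*, §18.2.
-/

noncomputable section

open CategoryTheory CategoryTheory.Limits NumberField IntermediateField Polynomial

namespace Summit.HodgeConjecture.CorCM.MultiFieldWeil

open Finset
open Literature.AlgebraicGeometry Literature.AlgebraicGeometry.Motives Literature.AlgebraicGeometry.HodgeTheory
open Literature.AlgebraicGeometry.ComplexMultiplication (IsCMTypeRealisation)
open Literature.AlgebraicTopology.SingularHomology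
open Literature.NumberTheory.ComplexMultiplication

open scoped Classical

/-! ## §1 One quintic step over a base of `5`-power degree: the number-field form -/

section Step

variable {k K : Type} [Field k] [NumberField k] [Field K] [NumberField K]

/-- **ONE QUINTIC STEP OVER A BASE OF `5`-POWER DEGREE.**  `i : k → K` with `[K : ℚ] = 5 [k : ℚ]`; `A ⊂ ℂ` a subfield containing `τ(k)` with
`[A : ℚ] = 5^m [k : ℚ]`; `s : K → ℂ` an embedding over `τ`.  If NO embedding of `K` over `τ` takes all its values in `A` (no `k`-embedding of `K` into `A`), then
`[A · s(K) : ℚ] = 5 [A : ℚ]`: a quintic extension and an extension of `5`-power degree admitting no embedding of the first are linearly disjoint (`natDegree_minpoly_eq_five_of_forall_root_not_mem` with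
`M = ℚ(τk)`, `E = A`, `b = s β`; a conjugate of `b` in `A` would be a root `γ ∈ A` of the minimal polynomial of `β` over `k`, i.e. the `k`-embedding
`K = k(β) → A`, `β ↦ γ`). [cite: Lang2002, V §1 Prop. 1.2, VI §1 Thm. 1.1 and V §2 Thm. 2.8] -/
theorem finrank_sup_adjoin_range_of_forall_not_range_subset_five (i : k →+* K) (h₅ : Module.finrank ℚ K = 5 * Module.finrank ℚ k)
    (A : IntermediateField ℚ ℂ) [FiniteDimensional ℚ A] {m : ℕ} (hA : Module.finrank ℚ A = 5 ^ m * Module.finrank ℚ k)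
    {τ : k →+* ℂ} (hτA : ∀ x, τ x ∈ A) {s : K →+* ℂ} (hs : s.comp i = τ)
    (hK : ∀ φ : K →+* ℂ, φ.comp i = τ → ¬ Set.range φ ⊆ (A : Set ℂ)) :
    Module.finrank ℚ ↥(A ⊔ adjoin ℚ (Set.range s)) = 5 * Module.finrank ℚ A := by
  letI : Algebra k K := i.toAlgebra
  haveI : IsScalarTower ℚ k K := IsScalarTower.of_algebraMap_eq fun q => by
    rw [RingHom.algebraMap_toAlgebra, eq_ratCast, eq_ratCast, map_ratCast]
  haveI : FiniteDimensional k K := FiniteDimensional.right ℚ k K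
  have hk5 : Module.finrank k K = 5 := by
    have h := Module.finrank_mul_finrank ℚ k K
    rw [h₅, mul_comm 5] at h
    exact Nat.eq_of_mul_eq_mul_left Module.finrank_pos h
  -- the base `M = ℚ(τk) ≤ A`, and `A` as an extension `E` of `M` of degree `5^m`
  set M : IntermediateField ℚ ℂ := adjoin ℚ (Set.range τ) with hMdef
  have hfinM : Module.finrank ℚ M = Module.finrank ℚ k := finrank_adjoin_range_ringHom τ
  haveI : FiniteDimensional ℚ M := Module.finite_of_finrank_pos (by rw [hfinM]; exact Module.finrank_pos)
  have hMA : M ≤ A := adjoin_le_iff.2 (by rintro _ ⟨x, rfl⟩; exact hτA x)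
  set E : IntermediateField M ℂ := extendScalars hMA with hEdef
  have hEA : ∀ {x : ℂ}, x ∈ E ↔ x ∈ A := mem_extendScalars hMA
  have hfinE : Module.finrank M E = 5 ^ m := by
    have htower := Module.finrank_mul_finrank ℚ M ↥E
    have h1 : Module.finrank ℚ ↥E = Module.finrank ℚ ↥A := rfl
    rw [h1, hA, hfinM, mul_comm (5 ^ m)] at htower
    exact Nat.eq_of_mul_eq_mul_left Module.finrank_pos htower
  let τM : k →+* M := τ.codRestrict M (fun x => subset_adjoin ℚ _ ⟨x, rfl⟩)
  have hτM_comp : (algebraMap M ℂ).comp τM = τ := RingHom.ext fun x => rfl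
  let τA : k →+* A := τ.codRestrict A hτA
  letI : Algebra k A := τA.toAlgebra
  -- a primitive element `β`, `b = s β`, the minimal polynomial `q` of `β` over `k` (a quintic) and `g` of `b` over `M`
  obtain ⟨β, hβ⟩ := Field.exists_primitive_element ℚ K
  set b : ℂ := s β with hbdef
  have hsb : Set.range s ⊆ (ℚ⟮b⟯ : IntermediateField ℚ ℂ) := range_subset_adjoin_of_primitive hβ s
  have hβint : IsIntegral k β := IsIntegral.of_finite k β
  have hβtop : k⟮β⟯ = ⊤ := by
    rw [eq_top_iff]
    intro x _
    have hx : x ∈ ℚ⟮β⟯ := by rw [hβ]; exact mem_top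
    have hle : ℚ⟮β⟯ ≤ (k⟮β⟯).restrictScalars ℚ := adjoin_le_iff.2 (Set.singleton_subset_iff.2 (mem_adjoin_simple_self k β))
    exact hle hx
  set q : k[X] := minpoly k β with hq
  have hbint : IsIntegral M b := ((IsIntegral.of_finite ℚ β).map s.toRatAlgHom).tower_top
  have hqb : aeval b (q.map τM) = 0 := by
    rw [aeval_def, eval₂_map, hτM_comp, ← hs, hbdef, ← Polynomial.hom_eval₂, ← RingHom.algebraMap_toAlgebra i, ← aeval_def, hq, minpoly.aeval, map_zero]
  have hdvd : minpoly M b ∣ q.map τM := minpoly.dvd M b hqb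
  have hMb : (M⟮b⟯).restrictScalars ℚ = adjoin ℚ (Set.range s) := by
    rw [show (M⟮b⟯).restrictScalars ℚ = M ⊔ ℚ⟮b⟯ from restrictScalars_adjoin_eq_sup ℚ M _]
    refine le_antisymm (sup_le (adjoin.mono ℚ _ _ ?_) (adjoin.mono ℚ _ _ (Set.singleton_subset_iff.2 ⟨β, rfl⟩))) ?_
    · rintro y ⟨x, rfl⟩
      exact ⟨i x, by rw [← hs]; rfl⟩
    · exact le_sup_of_le_right (adjoin_le_iff.2 hsb)
  have h5b : (minpoly M b).natDegree = 5 := by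
    rw [← adjoin.finrank hbint]
    have htower := Module.finrank_mul_finrank ℚ M ↥M⟮b⟯
    have h1 : Module.finrank ℚ ↥M⟮b⟯ = Module.finrank ℚ ↥((M⟮b⟯).restrictScalars ℚ) := rfl
    rw [h1, hMb, finrank_adjoin_range_ringHom s, h₅, hfinM, mul_comm 5] at htower
    exact Nat.eq_of_mul_eq_mul_left Module.finrank_pos htower
  -- NO conjugate of `b` lies in `A`: it would be a root `γ ∈ A` of `q`, i.e. a `k`-embedding `K = k(β) → A`
  have hNR : ∀ y : ℂ, aeval y (minpoly M b) = 0 → y ∉ E := by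
    intro y hy hyE
    have hyA : y ∈ A := hEA.1 hyE
    have hyq : aeval y (q.map τM) = 0 := aeval_eq_zero_of_dvd_aeval_eq_zero hdvd hy
    have hmem : (⟨y, hyA⟩ : A) ∈ (minpoly k β).aroots A := by
      rw [mem_aroots, ← hq]
      refine ⟨minpoly.ne_zero hβint, ?_⟩
      apply (algebraMap A ℂ).injective
      have h1 : (algebraMap A ℂ).comp τA = τ := RingHom.ext fun x => rfl
      rw [map_zero, aeval_def, RingHom.algebraMap_toAlgebra, Polynomial.hom_eval₂, h1, ← hτM_comp, ← eval₂_map, ← aeval_def]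
      exact hyq
    let φ₀ : k⟮β⟯ →ₐ[k] A := (algHomAdjoinIntegralEquiv k hβint).symm ⟨⟨y, hyA⟩, hmem⟩
    let e : K ≃ₐ[k] k⟮β⟯ := IntermediateField.topEquiv.symm.trans (IntermediateField.equivOfEq hβtop.symm)
    let φ : K →+* ℂ := (algebraMap A ℂ).comp (φ₀.toRingHom.comp e.toAlgHom.toRingHom)
    refine hK φ (RingHom.ext fun x => ?_) ?_
    · change (algebraMap A ℂ) (φ₀ (e (i x))) = τ x
      have h1 : i x = algebraMap k K x := rfl
      rw [h1, AlgEquiv.commutes, AlgHom.commutes]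
      rfl
    · rintro z ⟨x, rfl⟩
      exact (φ₀ (e x)).2
  -- the quintic step: `g` stays irreducible over `E`, `[E(b) : E] = 5`; then the degree of `A · s(K) = E(b)`
  have h5 : (minpoly E b).natDegree = 5 := natDegree_minpoly_eq_five_of_forall_root_not_mem E hfinE hbint h5b hNR
  have hbE : IsIntegral E b := hbint.tower_top
  have hEb : Module.finrank E E⟮b⟯ = 5 := by rw [adjoin.finrank hbE, h5]
  have hF : A ⊔ adjoin ℚ (Set.range s) = A ⊔ ℚ⟮b⟯ :=
    le_antisymm (sup_le_sup_left (adjoin_le_iff.2 hsb) A)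
      (sup_le_sup_left (adjoin.mono ℚ ({b} : Set ℂ) (Set.range s) (Set.singleton_subset_iff.2 ⟨β, hbdef.symm⟩)) A)
  have hres : ((E⟮b⟯).restrictScalars M).restrictScalars ℚ = A ⊔ ℚ⟮b⟯ := by
    rw [show (E⟮b⟯).restrictScalars M = adjoin M ((E : Set ℂ) ∪ {b}) from IntermediateField.restrictScalars_adjoin (F := M) (K := E) (S := {b}),
      show (adjoin M ((E : Set ℂ) ∪ {b})).restrictScalars ℚ = M ⊔ adjoin ℚ ((E : Set ℂ) ∪ {b}) from restrictScalars_adjoin_eq_sup ℚ M _,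
      adjoin_union, show ((E : Set ℂ)) = (A : Set ℂ) from rfl, show adjoin ℚ (A : Set ℂ) = A from adjoin_self ℚ A, ← sup_assoc,
      sup_eq_right.2 hMA]
  have hmul := Module.finrank_mul_finrank ℚ ↥E ↥(E⟮b⟯)
  rw [hEb] at hmul
  have hfin : Module.finrank ℚ ↥(A ⊔ ℚ⟮b⟯) = Module.finrank ℚ ↥(E⟮b⟯) := by rw [← hres]; rfl
  have hEA' : Module.finrank ℚ ↥E = Module.finrank ℚ ↥A := rfl
  rw [hF, hfin, ← hmul, hEA', mul_comm]

end Step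

/-! ## §2 The tower: `r` relative quintics, each with no `τ`-embedding into the compositum of the earlier ones -/

section Tower

variable {k : Type} [Field k] [NumberField k]

/-- **THE QUINTIC TOWER.**  `K_0, …, K_{r−1} ⊇ k` number fields of relative degree `5` with embeddings `s_m` over `τ : k → ℂ`; suppose that for every `m` NO
embedding of `K_m` over `τ` takes its values in the compositum `ℚ(τk) · s_0(K_0) ⋯ s_{m−1}(K_{m−1})`.  Then `[ℚ(τk) · s_0(K_0) ⋯ s_{r−1}(K_{r−1}) : ℚ] = 5^r [k : ℚ]`:
the `K_m` are linearly disjoint over `k` (induction on `r` by `finrank_sup_adjoin_range_of_forall_not_range_subset_five`, the earlier compositum having the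
`5`-power degree `5^r [k : ℚ]` that the quintic step requires).  For `r = 2` the hypothesis is `Hom_k(K_1, K_0) = ∅` (`finrank_adjoin_pair_of_isEmpty_ringHom_five`).
[cite: Lang2002, V §1 Prop. 1.2, VI §1 Thm. 1.1 and V §2 Thm. 2.8] -/
theorem finrank_adjoin_iUnion_of_quinticTower (r : ℕ) :
    ∀ {K : Fin r → Type} [∀ m, Field (K m)] [∀ m, NumberField (K m)] (i : ∀ m, k →+* K m)
      (h₅ : ∀ m, Module.finrank ℚ (K m) = 5 * Module.finrank ℚ k) {τ : k →+* ℂ} (s : ∀ m, K m →+* ℂ) (hs : ∀ m, (s m).comp (i m) = τ)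
      (hK : ∀ m (φ : K m →+* ℂ), φ.comp (i m) = τ →
        ¬ Set.range φ ⊆ (↑(adjoin ℚ (Set.range τ) ⊔ adjoin ℚ (⋃ j : {j : Fin r // j < m}, Set.range (s j.1))) : Set ℂ)),
      Module.finrank ℚ ↥(adjoin ℚ (Set.range τ) ⊔ adjoin ℚ (⋃ m, Set.range (s m))) = 5 ^ r * Module.finrank ℚ k := by
  induction r with
  | zero =>
    intro K _ _ i h₅ τ s hs hK
    rw [Set.iUnion_of_empty, adjoin_empty, sup_bot_eq, finrank_adjoin_range_ringHom, pow_zero, one_mul]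
  | succ r ih =>
    intro K _ _ i h₅ τ s hs hK
    -- the compositum `A` of the first `r` images, of degree `5^r [k : ℚ]` by induction
    set A : IntermediateField ℚ ℂ := adjoin ℚ (Set.range τ) ⊔ adjoin ℚ (⋃ m : Fin r, Set.range (s (Fin.castSucc m))) with hAdef
    have hA : Module.finrank ℚ A = 5 ^ r * Module.finrank ℚ k := by
      refine ih (K := fun m => K (Fin.castSucc m)) (fun m => i (Fin.castSucc m)) (fun m => h₅ _) (fun m => s (Fin.castSucc m)) (fun m => hs _)
        fun m φ hφ hsub => hK (Fin.castSucc m) φ hφ (hsub.trans ?_)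
      refine SetLike.coe_subset_coe.2 (sup_le_sup_left (adjoin.mono ℚ _ _ (Set.iUnion_subset fun j => ?_)) _)
      exact Set.subset_iUnion_of_subset (⟨Fin.castSucc j.1, Fin.castSucc_lt_castSucc_iff.2 j.2⟩ : {j' : Fin (r + 1) // j' < Fin.castSucc m})
        Set.Subset.rfl
    haveI : FiniteDimensional ℚ A := Module.finite_of_finrank_pos (by rw [hA]; exact mul_pos (pow_pos (by norm_num) r) Module.finrank_pos)
    have hτA : ∀ x, τ x ∈ A := fun x => (le_sup_left : adjoin ℚ (Set.range τ) ≤ A) (subset_adjoin ℚ _ ⟨x, rfl⟩)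
    -- the last field is linearly disjoint from `A`
    have hlast : ∀ φ : K (Fin.last r) →+* ℂ, φ.comp (i (Fin.last r)) = τ → ¬ Set.range φ ⊆ (A : Set ℂ) := by
      intro φ hφ hsub
      refine hK (Fin.last r) φ hφ (hsub.trans (SetLike.coe_subset_coe.2 (sup_le_sup_left (adjoin.mono ℚ _ _ (Set.iUnion_subset fun m => ?_)) _)))
      exact Set.subset_iUnion_of_subset (⟨Fin.castSucc m, Fin.castSucc_lt_last m⟩ : {j' : Fin (r + 1) // j' < Fin.last r}) Set.Subset.rfl
    have hstep := finrank_sup_adjoin_range_of_forall_not_range_subset_five (i (Fin.last r)) (h₅ _) A hA hτA (hs (Fin.last r)) hlast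
    -- the whole compositum is `A · s_last(K_last)`
    have hU : (⋃ m : Fin (r + 1), Set.range (s m)) = (⋃ m : Fin r, Set.range (s (Fin.castSucc m))) ∪ Set.range (s (Fin.last r)) := by
      ext x
      simp only [Set.mem_iUnion, Set.mem_union]
      exact Fin.exists_fin_succ'
    rw [hU, adjoin_union, ← sup_assoc, hstep, hA, pow_succ]
    ring

end Tower

/-! ## §3 The headline: any number of `(2,3)`-fivefolds over a quintic tower of decic CM fields -/

section Engine

variable {I : Type} {r : ℕ} {Kf : I → Type} [∀ i, Field (Kf i)] [∀ i, NumberField (Kf i)] [∀ i, IsCMField (Kf i)]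
  {i₀ : I} {is : Fin r → I} {τ : Kf i₀ →+* ℂ}
  {A : Fin (r + 1) → AbelianVariety ℂ} {Φ : ∀ j : Fin (r + 1), CMType (Kf (mfSlots i₀ is j))}
  {ι : ∀ j, 𝓞 (Kf (mfSlots i₀ is j)) →+* End (A j)}
  {θ : ∀ j, Kf (mfSlots i₀ is j) →+* Module.End ℂ (complexBetti (A j).X 1)}

/-- **ANY NUMBER OF `(2,3)`-FIVEFOLDS OVER A QUINTIC TOWER OF DECIC CM FIELDS — given ONLY Markman's hyperbolic-sixfold theorem.**  `E = A 0 ⊨ (k; {τ})`,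
`k = Kf i₀` imaginary quadratic; `F_m = A (m+1) ⊨ (K_m; Φ (m+1))` over DECIC `K_m = Kf (is m) ⊇ im m (k)` with TWO members of `Φ (m+1)` over `τ`; a family `s₀` of
`τ`-embeddings such that for every `m` NO `τ`-embedding of `K_m` takes its values in `ℚ(τk) · s₀_0(K_0) ⋯ s₀_{m−1}(K_{m−1})`.  Then the Hodge conjecture holds for
EVERY product of copies `⨁_j A (κ j)` — `E^a × F_0^{b_0} × ⋯ × F_{r−1}^{b_{r−1}}` (G2b's `hodgeConjectureFor_biproduct_comp_of_decics_of_finrank` with the degree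
`2 · 5^r` supplied by `finrank_adjoin_iUnion_of_quinticTower`).  `HC_CM` is NOT asserted. [cite: Markman2025SecantWeil, Thm 1.5.1]
[cite: Lang2002, VI §1 Thm. 1.1, Cor. 1.6 and V §2 Thm. 2.8] [cite: Shimura1998, §18.2 Lemma (i)] -/
theorem hodgeConjectureFor_biproduct_comp_of_decics_of_quinticTower (hM6 : Markman2025_weilClasses_algebraic_hyperbolicSixfold)
    {N : ℕ} (κ : Fin N → Fin (r + 1)) (h2 : Module.finrank ℚ (Kf i₀) = 2) (h10 : ∀ m : Fin r, Module.finrank ℚ (Kf (is m)) = 10)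
    (im : ∀ m : Fin r, Kf i₀ →+* Kf (is m)) (hA : ∀ j, IsCMTypeRealisation (Φ j) (A j) (ι j) (θ j)) (hΨ : ∀ σ : Kf i₀ →+* ℂ, σ ∈ (Φ 0).1 ↔ σ = τ)
    (h23 : ∀ m : Fin r, (Finset.univ.filter fun s : Kf (is m) →+* ℂ => s.comp (im m) = τ ∧ s ∈ (Φ m.succ).1).card = 2)
    (s₀ : ∀ m : Fin r, Kf (is m) →+* ℂ) (hs₀ : ∀ m, (s₀ m).comp (im m) = τ)
    (htower : ∀ (m : Fin r) (φ : Kf (is m) →+* ℂ), φ.comp (im m) = τ →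
      ¬ Set.range φ ⊆ (↑(adjoin ℚ (Set.range τ) ⊔ adjoin ℚ (⋃ j : {j : Fin r // j < m}, Set.range (s₀ j.1))) : Set ℂ)) :
    HodgeConjectureFor (⨁ fun j => A (κ j)).dim (⨁ fun j => A (κ j)).X :=
  hodgeConjectureFor_biproduct_comp_of_decics_of_finrank hM6 κ h2 h10 im hA hΨ h23 s₀ hs₀
    (by rw [finrank_adjoin_iUnion_of_quinticTower r im (fun m => by rw [h10 m, h2]) s₀ hs₀ htower, h2, mul_comm])

/-- **Dominated form** of `hodgeConjectureFor_biproduct_comp_of_decics_of_quinticTower`. [cite: Markman2025SecantWeil, Thm 1.5.1] -/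
theorem hodgeConjectureFor_of_avDominatedBy_comp_of_decics_of_quinticTower (hM6 : Markman2025_weilClasses_algebraic_hyperbolicSixfold)
    {N : ℕ} (κ : Fin N → Fin (r + 1)) (h2 : Module.finrank ℚ (Kf i₀) = 2) (h10 : ∀ m : Fin r, Module.finrank ℚ (Kf (is m)) = 10)
    (im : ∀ m : Fin r, Kf i₀ →+* Kf (is m)) (hA : ∀ j, IsCMTypeRealisation (Φ j) (A j) (ι j) (θ j)) (hΨ : ∀ σ : Kf i₀ →+* ℂ, σ ∈ (Φ 0).1 ↔ σ = τ)
    (h23 : ∀ m : Fin r, (Finset.univ.filter fun s : Kf (is m) →+* ℂ => s.comp (im m) = τ ∧ s ∈ (Φ m.succ).1).card = 2)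
    (s₀ : ∀ m : Fin r, Kf (is m) →+* ℂ) (hs₀ : ∀ m, (s₀ m).comp (im m) = τ)
    (htower : ∀ (m : Fin r) (φ : Kf (is m) →+* ℂ), φ.comp (im m) = τ →
      ¬ Set.range φ ⊆ (↑(adjoin ℚ (Set.range τ) ⊔ adjoin ℚ (⋃ j : {j : Fin r // j < m}, Set.range (s₀ j.1))) : Set ℂ))
    {X : AbelianVariety ℂ} (hX : Domination.AVDominatedBy X (⨁ fun j => A (κ j))) : HodgeConjectureFor X.dim X.X :=
  Domination.hodgeConjectureFor_of_avDominatedBy (hodgeConjectureFor_biproduct_comp_of_decics_of_quinticTower hM6 κ h2 h10 im hA hΨ h23 s₀ hs₀ htower) hX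

end Engine

/-! ## §4 Three `(2,3)`-fivefolds: `Hom(K₁, K₀) = ∅` and no `k`-embedding of `K₂` into `K₀ · K₁` -/

section Three

variable {I : Type} {Kf : I → Type} [∀ i, Field (Kf i)] [∀ i, NumberField (Kf i)] [∀ i, IsCMField (Kf i)]
  {i₀ : I} {is : Fin 3 → I} {τ : Kf i₀ →+* ℂ}
  {A : Fin (3 + 1) → AbelianVariety ℂ} {Φ : ∀ j : Fin (3 + 1), CMType (Kf (mfSlots i₀ is j))}
  {ι : ∀ j, 𝓞 (Kf (mfSlots i₀ is j)) →+* End (A j)}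
  {θ : ∀ j, Kf (mfSlots i₀ is j) →+* Module.End ℂ (complexBetti (A j).X 1)}

/-- **THREE `(2,3)`-FIVEFOLDS OVER DECIC CM FIELDS SHARING `k` — given ONLY Markman's hyperbolic-sixfold theorem.**  `E = A 0 ⊨ (k; {τ})`;
`F_m = A (m+1) ⊨ (K_m; Φ (m+1))` (`m : Fin 3`) over DECIC `K_m ⊇ im m (k)` with two members of the type over `τ`; HYPOTHESES: `Hom(K_1, K_0) = ∅`, and for
`τ`-embeddings `s₀, s₁` of `K_0, K_1` NO `τ`-embedding of `K_2` takes its values in `ℚ(τk) · s₀(K_0) · s₁(K_1)`.  Then the Hodge conjecture holds for EVERY product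
of copies `E^a × F_0^b × F_1^c × F_2^d`.  `HC_CM` is NOT asserted. [cite: Markman2025SecantWeil, Thm 1.5.1] [cite: Lang2002, VI §1 Thm. 1.1, Cor. 1.6 and V §2 Thm. 2.8]
[cite: Shimura1998, §18.2 Lemma (i)] -/
theorem hodgeConjectureFor_biproduct_comp_of_three_decics (hM6 : Markman2025_weilClasses_algebraic_hyperbolicSixfold)
    {N : ℕ} (κ : Fin N → Fin (3 + 1)) (h2 : Module.finrank ℚ (Kf i₀) = 2) (h10 : ∀ m : Fin 3, Module.finrank ℚ (Kf (is m)) = 10)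
    (im : ∀ m : Fin 3, Kf i₀ →+* Kf (is m)) (hA : ∀ j, IsCMTypeRealisation (Φ j) (A j) (ι j) (θ j)) (hΨ : ∀ σ : Kf i₀ →+* ℂ, σ ∈ (Φ 0).1 ↔ σ = τ)
    (h23 : ∀ m : Fin 3, (Finset.univ.filter fun s : Kf (is m) →+* ℂ => s.comp (im m) = τ ∧ s ∈ (Φ m.succ).1).card = 2)
    (hK : IsEmpty (Kf (is 1) →+* Kf (is 0))) (s₀ : Kf (is 0) →+* ℂ) (s₁ : Kf (is 1) →+* ℂ) (hs₀ : s₀.comp (im 0) = τ) (hs₁ : s₁.comp (im 1) = τ)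
    (hK₂ : ∀ φ : Kf (is 2) →+* ℂ, φ.comp (im 2) = τ → ¬ Set.range φ ⊆ (↑(adjoin ℚ (Set.range τ) ⊔ adjoin ℚ (Set.range s₀ ∪ Set.range s₁)) : Set ℂ)) :
    HodgeConjectureFor (⨁ fun j => A (κ j)).dim (⨁ fun j => A (κ j)).X := by
  obtain ⟨s₂, hs₂⟩ : ∃ s : Kf (is 2) →+* ℂ, s.comp (im 2) = τ := by
    have hc := SexticOcticWeil.card_filter_comp_eq_of_finrank (n := 5) (im 2) (by rw [h10 2]) h2 τ
    obtain ⟨s, hs⟩ := Finset.card_pos.1 (by rw [hc]; norm_num)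
    exact ⟨s, (Finset.mem_filter.1 hs).2⟩
  let t : ∀ m : Fin 3, Kf (is m) →+* ℂ := fun m => match m with
    | ⟨0, _⟩ => s₀
    | ⟨1, _⟩ => s₁
    | ⟨2, _⟩ => s₂
  have ht : ∀ m, (t m).comp (im m) = τ := fun m => by
    fin_cases m
    · exact hs₀
    · exact hs₁
    · exact hs₂
  refine hodgeConjectureFor_biproduct_comp_of_decics_of_quinticTower hM6 κ h2 h10 im hA hΨ h23 t ht fun m φ hφ hsub => ?_
  fin_cases m
  · refine not_range_subset_adjoin_range (by rw [h10, h2]; norm_num) τ φ (hsub.trans (SetLike.coe_subset_coe.2 ?_))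
    refine sup_le le_rfl (adjoin_le_iff.2 (Set.iUnion_subset fun j => ?_))
    exact absurd j.2 (by simp)
  · refine hK.false (Classical.choice (nonempty_ringHom_of_range_subset (im 0) hs₀ φ (hsub.trans (SetLike.coe_subset_coe.2 ?_))))
    refine sup_le_sup_left (adjoin_le_iff.2 (Set.iUnion_subset fun j => ?_)) _
    obtain ⟨j, hj⟩ := j
    have hj0 : j = 0 := by
      fin_cases j
      · rfl
      · exact absurd hj (by decide)
      · exact absurd hj (by decide)
    subst hj0
    exact subset_adjoin ℚ _
  · refine hK₂ φ hφ (hsub.trans (SetLike.coe_subset_coe.2 (sup_le_sup_left (adjoin.mono ℚ _ _ (Set.iUnion_subset fun j => ?_)) _)))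
    obtain ⟨j, hj⟩ := j
    fin_cases j
    · exact Set.subset_union_left
    · exact Set.subset_union_right
    · exact absurd hj (by decide)

end Three

/-! ## §5 `vec` form: three Weil-type CM fivefolds `F₀, F₁, F₂` with fields `K₀, K₁, K₂ ∋ k` -/

section Vec

variable {k K₀ K₁ K₂ : Type} [Field k] [NumberField k] [IsCMField k] [Field K₀] [NumberField K₀] [IsCMField K₀]
  [Field K₁] [NumberField K₁] [IsCMField K₁] [Field K₂] [NumberField K₂] [IsCMField K₂] {N : ℕ}
  {E F₀ F₁ F₂ : AbelianVariety ℂ} {Ψ : CMType k} {Φ₀ : CMType K₀} {Φ₁ : CMType K₁} {Φ₂ : CMType K₂}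
  {ιE : 𝓞 k →+* End E} {θE : k →+* Module.End ℂ (complexBetti E.X 1)}
  {ι₀ : 𝓞 K₀ →+* End F₀} {θ₀ : K₀ →+* Module.End ℂ (complexBetti F₀.X 1)}
  {ι₁ : 𝓞 K₁ →+* End F₁} {θ₁ : K₁ →+* Module.End ℂ (complexBetti F₁.X 1)}
  {ι₂ : 𝓞 K₂ →+* End F₂} {θ₂ : K₂ →+* Module.End ℂ (complexBetti F₂.X 1)}

/-- **THREE WEIL-TYPE CM FIVEFOLDS OVER DECIC CM FIELDS CONTAINING `k` — `vec` form, given ONLY Markman's hyperbolic-sixfold theorem.**  `k` imaginary quadratic,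
`E ⊨ (k; Ψ)`; `F_m ⊨ (K_m; Φ_m)` (`m = 0, 1, 2`) abelian FIVEFOLDS with CM by DECIC CM fields `K_m ⊇ i_m(k)` whose types have two or three members over one
(hence each) embedding of `k`; FIELD HYPOTHESES: `Hom(K₁, K₀) = ∅`, and for all embeddings `τ`, `s₀ ⊃ τ`, `s₁ ⊃ τ` no embedding of `K₂` over `τ` has image
inside `ℚ(τk) · s₀(K₀) · s₁(K₁)`.  Then for every `κ : Fin N → Fin 4` — every `E^a × F₀^b × F₁^c × F₂^d` — every rational `(p,p)`-class on `⨁_j ![E, F₀, F₁, F₂] (κ j)`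
is algebraic, GIVEN ONLY `Markman2025_weilClasses_algebraic_hyperbolicSixfold`.  `HC_CM` is NOT asserted. [cite: Markman2025SecantWeil, Thm 1.5.1]
[cite: Shimura1998, §18.2 Lemma (i)] [cite: Lang2002, V §1 Prop. 1.2, VI §1 Thm. 1.1] -/
theorem hodgeConjectureFor_biproduct_comp_vec_of_three_decics_of_isEmpty (hM6 : Markman2025_weilClasses_algebraic_hyperbolicSixfold)
    (h2 : Module.finrank ℚ k = 2) (h10₀ : Module.finrank ℚ K₀ = 10) (h10₁ : Module.finrank ℚ K₁ = 10) (h10₂ : Module.finrank ℚ K₂ = 10)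
    (i₀ : k →+* K₀) (i₁ : k →+* K₁) (i₂ : k →+* K₂)
    (hE : IsCMTypeRealisation Ψ E ιE θE) (hF₀ : IsCMTypeRealisation Φ₀ F₀ ι₀ θ₀) (hF₁ : IsCMTypeRealisation Φ₁ F₁ ι₁ θ₁)
    (hF₂ : IsCMTypeRealisation Φ₂ F₂ ι₂ θ₂) {τ : k →+* ℂ} (hτΨ : τ ∈ Ψ.1)
    (h23₀ : (Finset.univ.filter fun s : K₀ →+* ℂ => s.comp i₀ = τ ∧ s ∈ Φ₀.1).card = 2 ∨
      (Finset.univ.filter fun s : K₀ →+* ℂ => s.comp i₀ = τ ∧ s ∈ Φ₀.1).card = 3)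
    (h23₁ : (Finset.univ.filter fun s : K₁ →+* ℂ => s.comp i₁ = τ ∧ s ∈ Φ₁.1).card = 2 ∨
      (Finset.univ.filter fun s : K₁ →+* ℂ => s.comp i₁ = τ ∧ s ∈ Φ₁.1).card = 3)
    (h23₂ : (Finset.univ.filter fun s : K₂ →+* ℂ => s.comp i₂ = τ ∧ s ∈ Φ₂.1).card = 2 ∨
      (Finset.univ.filter fun s : K₂ →+* ℂ => s.comp i₂ = τ ∧ s ∈ Φ₂.1).card = 3)
    (hK : IsEmpty (K₁ →+* K₀))
    (hK₂ : ∀ (s₀ : K₀ →+* ℂ) (s₁ : K₁ →+* ℂ) (φ : K₂ →+* ℂ), s₀.comp i₀ = τ → s₁.comp i₁ = τ → φ.comp i₂ = τ →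
      ¬ Set.range φ ⊆ (↑(adjoin ℚ (Set.range τ) ⊔ adjoin ℚ (Set.range s₀ ∪ Set.range s₁)) : Set ℂ))
    (κ : Fin N → Fin 4) :
    HodgeConjectureFor (⨁ fun j => (![E, F₀, F₁, F₂] : Fin 4 → AbelianVariety ℂ) (κ j)).dim
      (⨁ fun j => (![E, F₀, F₁, F₂] : Fin 4 → AbelianVariety ℂ) (κ j)).X := by
  obtain ⟨Φ₀', ι₀', θ₀', hF₀', h2₀⟩ := exists_realisation_card_eq_two h10₀ h2 i₀ hF₀ τ h23₀
  obtain ⟨Φ₁', ι₁', θ₁', hF₁', h2₁⟩ := exists_realisation_card_eq_two h10₁ h2 i₁ hF₁ τ h23₁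
  obtain ⟨Φ₂', ι₂', θ₂', hF₂', h2₂⟩ := exists_realisation_card_eq_two h10₂ h2 i₂ hF₂ τ h23₂
  have hττ : ComplexEmbedding.conjugate τ ≠ τ := QuarticCM.conjugate_ne τ
  have hk : ∀ σ : k →+* ℂ, σ = τ ∨ σ = ComplexEmbedding.conjugate τ := fun σ => QuarticCM.eq_or_eq_conjugate_of_quadratic h2 τ σ
  have hΨ : ∀ σ : k →+* ℂ, σ ∈ Ψ.1 ↔ σ = τ := by
    intro σ
    rcases hk σ with rfl | rfl
    · exact ⟨fun _ => rfl, fun _ => hτΨ⟩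
    · exact ⟨fun h => absurd h ((Ψ.2 τ).1 hτΨ), fun h => absurd h hττ⟩
  obtain ⟨s₀, hs₀⟩ : ∃ s : K₀ →+* ℂ, s.comp i₀ = τ := by
    have hc := SexticOcticWeil.card_filter_comp_eq_of_finrank (n := 5) i₀ (by rw [h10₀]) h2 τ
    obtain ⟨s, hs⟩ := Finset.card_pos.1 (by rw [hc]; norm_num)
    exact ⟨s, (Finset.mem_filter.1 hs).2⟩
  obtain ⟨s₁, hs₁⟩ : ∃ s : K₁ →+* ℂ, s.comp i₁ = τ := by
    have hc := SexticOcticWeil.card_filter_comp_eq_of_finrank (n := 5) i₁ (by rw [h10₁]) h2 τ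
    obtain ⟨s, hs⟩ := Finset.card_pos.1 (by rw [hc]; norm_num)
    exact ⟨s, (Finset.mem_filter.1 hs).2⟩
  let Kf : Fin 4 → Type := Fin.cons k (Fin.cons K₀ (Fin.cons K₁ (Fin.cons K₂ finZeroElim)))
  letI instF : ∀ j, Field (Kf j) := Fin.cons ‹Field k› (Fin.cons ‹Field K₀› (Fin.cons ‹Field K₁› (Fin.cons ‹Field K₂› finZeroElim)))
  letI instN : ∀ j, NumberField (Kf j) :=
    Fin.cons ‹NumberField k› (Fin.cons ‹NumberField K₀› (Fin.cons ‹NumberField K₁› (Fin.cons ‹NumberField K₂› finZeroElim)))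
  haveI instC : ∀ j, IsCMField (Kf j) :=
    Fin.cons ‹IsCMField k› (Fin.cons ‹IsCMField K₀› (Fin.cons ‹IsCMField K₁› (Fin.cons ‹IsCMField K₂› finZeroElim)))
  let Φf : ∀ j : Fin 4, CMType (Kf (mfSlots (0 : Fin 4) Fin.succ j)) := Fin.cons Ψ (Fin.cons Φ₀' (Fin.cons Φ₁' (Fin.cons Φ₂' finZeroElim)))
  let ιf : ∀ j : Fin 4, 𝓞 (Kf (mfSlots (0 : Fin 4) Fin.succ j)) →+* End ((![E, F₀, F₁, F₂] : Fin 4 → AbelianVariety ℂ) j) :=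
    Fin.cons ιE (Fin.cons ι₀' (Fin.cons ι₁' (Fin.cons ι₂' finZeroElim)))
  let θf : ∀ j : Fin 4, Kf (mfSlots (0 : Fin 4) Fin.succ j) →+* Module.End ℂ (complexBetti ((![E, F₀, F₁, F₂] : Fin 4 → AbelianVariety ℂ) j).X 1) :=
    Fin.cons θE (Fin.cons θ₀' (Fin.cons θ₁' (Fin.cons θ₂' finZeroElim)))
  have hAf : ∀ j, IsCMTypeRealisation (Φf j) ((![E, F₀, F₁, F₂] : Fin 4 → AbelianVariety ℂ) j) (ιf j) (θf j) :=
    Fin.cons hE (Fin.cons hF₀' (Fin.cons hF₁' (Fin.cons hF₂' finZeroElim)))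
  let im : ∀ m : Fin 3, Kf 0 →+* Kf (Fin.succ m) := Fin.cons i₀ (Fin.cons i₁ (Fin.cons i₂ finZeroElim))
  have h10 : ∀ m : Fin 3, Module.finrank ℚ (Kf (Fin.succ m)) = 10 := by
    intro m
    fin_cases m
    · exact h10₀
    · exact h10₁
    · exact h10₂
  have h23 : ∀ m : Fin 3, (Finset.univ.filter fun s : Kf (Fin.succ m) →+* ℂ => s.comp (im m) = τ ∧ s ∈ (Φf m.succ).1).card = 2 := by
    intro m
    fin_cases m
    · exact h2₀
    · exact h2₁
    · exact h2₂
  have hK' : IsEmpty (Kf (Fin.succ 1) →+* Kf (Fin.succ 0)) := hK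
  have hs₀' : (s₀ : Kf (Fin.succ 0) →+* ℂ).comp (im 0) = τ := hs₀
  have hs₁' : (s₁ : Kf (Fin.succ 1) →+* ℂ).comp (im 1) = τ := hs₁
  have hK₂' : ∀ φ : Kf (Fin.succ 2) →+* ℂ, φ.comp (im 2) = τ →
      ¬ Set.range φ ⊆ (↑(adjoin ℚ (Set.range τ) ⊔ adjoin ℚ (Set.range (s₀ : Kf (Fin.succ 0) →+* ℂ) ∪ Set.range (s₁ : Kf (Fin.succ 1) →+* ℂ))) : Set ℂ) :=
    fun φ hφ => hK₂ s₀ s₁ φ hs₀ hs₁ hφ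
  exact hodgeConjectureFor_biproduct_comp_of_three_decics (Kf := Kf) (i₀ := (0 : Fin 4)) (is := Fin.succ)
    (A := (![E, F₀, F₁, F₂] : Fin 4 → AbelianVariety ℂ)) (Φ := Φf) (ι := ιf) (θ := θf) hM6 κ h2 h10 im hAf hΨ h23 hK' s₀ s₁ hs₀' hs₁' hK₂'

end Vec

end Summit.HodgeConjecture.CorCM.MultiFieldWeil

end
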